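import Summits.QuantumFields.BalabanUV.Beta.GAN24.BornLambdaContactPairEntry
import Summits.QuantumFields.BalabanUV.Beta.GAN24.BornLambdaContactLineage
import Summits.QuantumFields.BalabanUV.Beta.GAN24.ContactGaugeStaircaseCauchyPack

/-!
# `GAN24.BornLambdaContactPairLineage` — CT-ROUTE, the born-Λ RATE half («(C4)-DIFF», leaf-01 g61's `BORN-CONTACT-DIFF-PLAN-v0.md`, module D3a; `d = 3`):
# **THE WEIGHTED CONTACT ENTRY OF A PAIR OF CONSECUTIVE Λ LINEAGES `(i+1, i+1+n+1) ∕ (i, i+n+1)`, EVERY LETTER A HYPOTHESIS** — (C4) PART 4's lineage count run on the PAIR: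
# `|W·C′ − W·C| ≤ C_fin·((n+1)·(Lc⁻¹)^{n+1})·θ^{i+n}·e^{−(κ∕12)(‖x−u′‖∞+‖z−u′‖∞)}`, `W = (cE·Lc^8)^{n+1}`, `|cE| ≤ Lc^4`.

NOT IN PRINT; OUR PROOF (G-an2-4 formalisation swarm, leaf prover `b2b-balaban-gan24-formalise-leaf-01`, gen 61; INTENT «(C4)-DIFF» journal `CLAIMS.log` l.35799; socket holder leaf-06 g41's
GO l.35804).  HONEST FRAMING (cell contract, verbatim): «discharging `BetaPertH` makes Bałaban's UV stability UNCONDITIONAL — a real constructive-QFT result; it is NOT the continuum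
limit and NOT the Clay problem.»  HONEST DEPENDENCY (verbatim): «continuum YM on T⁴ ⇐ BetaPertH ∧ nine spine estimates (0/9 proved); BetaPertH ⇐ (D1) ∧ (D4) ∧ CAP+tail; G-an2-4 gates
asym, D1 and NE2/3/4.»
ABSOLUTE RULE (cell charter, verbatim): «No internally-minted statement may enter as a cited fact. Every hypothesis is either kernel-proved in this package or a verbatim quotation of a
PUBLISHED theorem with page reference. The manuscript(s) under audit are NOT citable for their own disputed steps — they are the thing under adjudication; programme-internal
(2001/route/tribunal) claims are never citable.»

## What is proved (`d = 3`, `2 ≤ Lc`, in-block root)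
The two members have the SAME chain length `n` and live on ONE lattice (relative coordinates); they differ through the birth level only.  Every slot's difference is a LETTER taken
as a HYPOTHESIS at rate `θ^{i+n}`: the undressed legs (CT-4a shape `hCau`), the gauge staircase pieces (gan24-p2 g34's `ContactGaugeStaircaseCauchyPack.gauge_succ_sub_eq_staircase ∕
abs_gaugePieceSucc_le` over `hCau`), the brackets (`hbrΔ`); the undifferenced slots carry (C4) PART 4's letters ((N1) `hN1`, the dressed envelope `hE`, the gauge sup `hlam`, the
coefficients' decay∕transversality, the bracket letters `hbr′`, `hbr`).  D2c `BornLambdaContactPairEntry.abs_contactPair_entry_le` bounds the pair entry with ONE Δ-letter in every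
term; the three cell-pair polynomials collapse EXACTLY to `θ^{i+n}·((Lc^n)^7)⁻¹·(X⁻¹)²·(C₁·(T_Δ·C₁ + 2·T_b·c_C))·(64Lc + 512Lc² + (32Lc² + 768Lc³)·n)` (`X = Lc^{5(n+1)}`), and PART 4's
`BornLambdaContactLineage.units_le` counts the powers against the weight.
* §1 `poly_le` (the cell polynomial against `n + 1`).
* §2 **`abs_weight_mul_contactPair_le_three`** — the statement in the title with explicit `C_fin = Lc^3·((2Lc^4)⁻¹·((4·E2C)·(C₁·(T_Δ·C₁ + 2·T_b·c_C))·(Lc·(64 + 544Lc + 768Lc²))·Zl 4 (κ∕16)))`,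
  `κ = min δ_K κ₁`; the `inl∕inl` block by D2c, the others vanish (`isFF_push₃`).
[folklore] bookkeeping over the files named above BY NAME; 0 `def`, 0 cited facts, 0 `def … : Prop`, 0 sorry, 0 wall binders; NO estimate of Bałaban's beyond what the hypotheses
carry; discharges NOTHING by itself (D3b `BornLambdaContactDrift.exists_hPc_three` discharges every letter from the tree and ENDS on leaf-06 g41's `hPc`); NEVER «G-an2-4 closed»; NOT D1,
NOT BetaPertH, NOT continuum, NOT Clay.
-/

noncomputable section

open Finset
open scoped BigOperators
open Literature.MathematicalPhysics.QuantumFieldTheory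
open Literature.MathematicalPhysics.QuantumFieldTheory.LatticeForm (quo)
open Literature.MathematicalPhysics.QuantumFieldTheory.Balaban1983to89
open Literature.MathematicalPhysics.QuantumFieldTheory.Balaban1983to89.Beta
open B4ContourShift (supNorm supNorm_nonneg)
open B12Sec2to5 (l1 l1_nonneg)
open ExpKernelCalculus (MKer Zl Zl_nonneg)
open AffineAveraging (Form0 Form1 Site box toSite unitVec dz)
open AveragingContours (blk)
open AveragingHessianKernels (ell)
open AveragingHessianKernelsRooted (hessFFAt)
open OneStepResolventKernel (Fib)
open InterLevelTransport (SLam)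
open KernelWard (divV)
open KKTFluctuationKernel (delta1)
open BalabanCompositeJets (respStep)
open Summit.QuantumFields.BalabanUV.Beta.AxialProjectorBlockMean (bmGaugeAt)
open Summit.QuantumFields.BalabanUV.Beta.GAN24.RespStepBmDecompLegs (legAct)
open Summit.QuantumFields.BalabanUV.Beta.GAN24.RespStepBmDecompPsi (Psi)
open Summit.QuantumFields.BalabanUV.Beta.GAN24.RespStepBmDecompExact (respStepBmSeq)
open Summit.QuantumFields.BalabanUV.Beta.GAN24.Push4Iter (legChain)
open Summit.QuantumFields.BalabanUV.Beta.GAN24.Push3 (push₃ isFF_push₃)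
open Summit.QuantumFields.BalabanUV.Beta.GAN24.Push3LegTelescope (abs_le_of_env' summable_of_env')
open Summit.QuantumFields.BalabanUV.Beta.GAN24.ContactGaugeStaircase (gauge_eq_staircase abs_gaugePiece_le)
open Summit.QuantumFields.BalabanUV.Beta.GAN24.ContactGaugeStaircaseCauchyPack (gauge_succ_sub_eq_staircase abs_gaugePieceSucc_le)
open Summit.QuantumFields.BalabanUV.Beta.GAN24.ContactLambdaCellBound (exp_env_mono_rate)
open Summit.QuantumFields.BalabanUV.Beta.GAN24.BornLambdaContactPairEntry (abs_contactPair_entry_le)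
open Summit.QuantumFields.BalabanUV.Beta.GAN24.BornLambdaContactLineage (units_le)
open Summit.QuantumFields.BalabanUV.Beta.GAN24.UndressedResponseUnits (inv_cast_pow_pow)

namespace Summit.QuantumFields.BalabanUV.Beta.GAN24.BornLambdaContactPairLineage

variable {Lc : ℕ} [NeZero Lc]

/-! ## §1 The cell polynomial -/

omit [NeZero Lc] in
/-- [folklore] the cell polynomial of (C4) PART 4 against `n + 1`: `64Lc + 512Lc² + (32Lc² + 768Lc³)·n ≤ (n+1)·(Lc·(64 + 544Lc + 768Lc²))`. -/
theorem poly_le (n : ℕ) :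
    64 * (Lc : ℝ) + 512 * (Lc : ℝ) ^ 2 + (32 * (Lc : ℝ) ^ 2 + 768 * (Lc : ℝ) ^ 3) * n
      ≤ ((n : ℝ) + 1) * ((Lc : ℝ) * (64 + 544 * Lc + 768 * (Lc : ℝ) ^ 2)) := by
  have hL : (0 : ℝ) ≤ (Lc : ℝ) := Nat.cast_nonneg _
  have hn : (0 : ℝ) ≤ n := Nat.cast_nonneg _
  nlinarith [mul_nonneg hL hn, mul_nonneg (mul_nonneg hL hL) hn, mul_nonneg (mul_nonneg (mul_nonneg hL hL) hL) hn, mul_nonneg hL hL,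
    mul_nonneg (mul_nonneg hL hL) hL]

/-! ## §2 The weighted contact entry of a PAIR of consecutive Λ lineages, every letter a hypothesis -/

section Pair

variable {rr : Fin (3 + 1) → ℕ} {i n : ℕ} {cE : ℝ} {C₁ cC θ κ₁ KE κE Clam Cc' δc' Cc δc Tb TΔ δK : ℝ}
  {c' c : Fin (3 + 1) → (Fin (3 + 1) → ℤ) → Fin (3 + 1) → (Fin (3 + 1) → ℤ) → ℝ}

-- buildfix (ops-buildfix-2 g12, 2026-08-21; T22 digest row): the build lane counts ≈10–30 % more heartbeats than the gate's farm
-- check for this proof (cliff measured on the farm: fails at 160 000 — :321/:323 —, passes at 200 000 and 400 000); statement unchanged.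
set_option maxHeartbeats 400000 in
/-- NOT IN PRINT; OUR PROOF.  **THE WEIGHTED CONTACT ENTRY OF THE PAIR `(i+1, i+1+n+1) ∕ (i, i+n+1)` OF Λ LINEAGES** (`d = 3`, `2 ≤ Lc`, in-block root; chain length `n` for both;
legs `T′ = legChain (respStepBmSeq ρ Lc) (i+1) n`, `B′ = respStep (Lc^(i+1)) (Lc^(i+1+n+1))`, `T = legChain … i n`, `B = respStep (Lc^i) (Lc^(i+n+1))`; coefficient families `c′`, `c`):
under (N1) `(C₁, κ₁)`, CT-4a `(c_C, θ, κ₁)` (same rate), the dressed envelope `(K_E, κ_E)` and the gauge sup `C_λ` (both uniform in the birth level), the coefficients' decays and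
transversality, the two bracket letters `T_b·((Lc^n)^7)⁻¹·e^{−δ_K‖·‖}` and the bracket PAIR letter `T_Δ·θ^{i+n}·((Lc^n)^7)⁻¹·e^{−δ_K‖·‖}`, the weight pin `|cE| ≤ Lc^4`; with `κ = min δ_K κ₁`,
for ALL `κ′ u′ x z a b`:
`|W·C′ − W·C| ≤ (Lc^3·((2Lc^4)⁻¹·((4·E2C)·(C₁·(T_Δ·C₁ + 2·T_b·c_C))·(Lc·(64 + 544Lc + 768Lc²))·Zl 4 (κ∕16))))·((n+1)·(Lc⁻¹)^{n+1})·θ^{i+n}·e^{−(κ∕12)(‖x−u′‖∞+‖z−u′‖∞)}`. -/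
theorem abs_weight_mul_contactPair_le_three (hLc : 2 ≤ Lc) (hrr : rr ∈ box (3 + 1) Lc) (hcE : |cE| ≤ (Lc : ℝ) ^ 4)
    (hN1 : ∀ (m k : ℕ) (μ : Fin (3 + 1)) (z : Site (3 + 1)) (l'' : Fin (3 + 1)) (w' : Site (3 + 1)),
      |respStep (d := 3) (Lc ^ m) (Lc ^ (m + k + 1)) μ z l'' w'| ≤
        C₁ * ((Lc : ℝ) ^ (5 * (k + 1)))⁻¹ * Real.exp (-(κ₁ * supNorm (quo (Lc ^ (k + 1)) w' - z))))
    (hCau : ∀ (s k : ℕ) (μ : Fin (3 + 1)) (z : Site (3 + 1)) (l : Fin (3 + 1)) (w : Site (3 + 1)),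
      |respStep (d := 3) (Lc ^ (s + 1)) (Lc ^ (s + k + 2)) μ z l w - respStep (d := 3) (Lc ^ s) (Lc ^ (s + k + 1)) μ z l w|
        ≤ cC * θ ^ (s + k) * ((((Lc ^ (k + 1) : ℕ) : ℝ)) ^ (3 + 2))⁻¹ * Real.exp (-(κ₁ * supNorm (quo (Lc ^ (k + 1)) w - z))))
    (hκ₁ : 0 < κ₁) (hC₁ : 0 ≤ C₁) (hcC : 0 ≤ cC) (hθ : 0 ≤ θ)
    (hE : ∀ m μ z l u, |legChain (respStepBmSeq (d := 3) (toSite rr) Lc) m n μ z l u| ≤ KE * Real.exp (-(κE * supNorm (quo (Lc ^ (n + 1)) u - z))))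
    (hκE : 0 < κE)
    (hlam : ∀ m μ z u, |(Psi (toSite rr) Lc m n (delta1 μ z) - bmGaugeAt (toSite rr) (respStep (d := 3) (Lc ^ m) (Lc ^ (m + n + 1)) μ z) Lc) u| ≤ Clam)
    (hc' : ∀ μ y l u, |c' μ y l u| ≤ Cc' * Real.exp (-δc' * l1 ((Lc : ℤ) • y - u))) (hδc' : 0 < δc') (hCc' : 0 ≤ Cc')
    (hdiv' : ∀ u, divV (SLam Lc c' (fun μ y => hessFFAt (toSite rr) Lc μ y)) u = 0)
    (hc : ∀ μ y l u, |c μ y l u| ≤ Cc * Real.exp (-δc * l1 ((Lc : ℤ) • y - u))) (hδc : 0 < δc) (hCc : 0 ≤ Cc)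
    (hdiv : ∀ u, divV (SLam Lc c (fun μ y => hessFFAt (toSite rr) Lc μ y)) u = 0)
    (hbr' : ∀ (κ' : Fin (3 + 1)) (u' : Site (3 + 1)) μ y, |∑' u, ∑ l, legChain (respStepBmSeq (d := 3) (toSite rr) Lc) (i + 1) n κ' u' l u * c' μ y l u|
      ≤ Tb * ((((Lc : ℝ) ^ n) ^ (2 * 3 + 1))⁻¹) * Real.exp (-(δK * supNorm (quo (Lc ^ n) y - u'))))
    (hbr : ∀ (κ' : Fin (3 + 1)) (u' : Site (3 + 1)) μ y, |∑' u, ∑ l, legChain (respStepBmSeq (d := 3) (toSite rr) Lc) i n κ' u' l u * c μ y l u|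
      ≤ Tb * ((((Lc : ℝ) ^ n) ^ (2 * 3 + 1))⁻¹) * Real.exp (-(δK * supNorm (quo (Lc ^ n) y - u'))))
    (hbrΔ : ∀ (κ' : Fin (3 + 1)) (u' : Site (3 + 1)) μ y,
      |(∑' u, ∑ l, legChain (respStepBmSeq (d := 3) (toSite rr) Lc) (i + 1) n κ' u' l u * c' μ y l u)
          - ∑' u, ∑ l, legChain (respStepBmSeq (d := 3) (toSite rr) Lc) i n κ' u' l u * c μ y l u|
        ≤ TΔ * θ ^ (i + n) * ((((Lc : ℝ) ^ n) ^ (2 * 3 + 1))⁻¹) * Real.exp (-(δK * supNorm (quo (Lc ^ n) y - u'))))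
    (hδK : 0 < δK) (hTb : 0 ≤ Tb) (hTΔ : 0 ≤ TΔ)
    (κ' : Fin (3 + 1)) (u' x z : Site (3 + 1)) (a b : Fib 3) :
    |(cE * (Lc : ℝ) ^ (2 * (3 + 1))) ^ (n + 1) *
        (push₃ (legChain (respStepBmSeq (d := 3) (toSite rr) Lc) (i + 1) n) (legChain (respStepBmSeq (d := 3) (toSite rr) Lc) (i + 1) n)
            (legChain (respStepBmSeq (d := 3) (toSite rr) Lc) (i + 1) n) (SLam Lc c' (fun μ y => hessFFAt (toSite rr) Lc μ y)) κ' u' x z a b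
          - push₃ (respStep (d := 3) (Lc ^ (i + 1)) (Lc ^ (i + 1 + n + 1))) (respStep (d := 3) (Lc ^ (i + 1)) (Lc ^ (i + 1 + n + 1)))
            (respStep (d := 3) (Lc ^ (i + 1)) (Lc ^ (i + 1 + n + 1))) (SLam Lc c' (fun μ y => hessFFAt (toSite rr) Lc μ y)) κ' u' x z a b)
      - (cE * (Lc : ℝ) ^ (2 * (3 + 1))) ^ (n + 1) *
        (push₃ (legChain (respStepBmSeq (d := 3) (toSite rr) Lc) i n) (legChain (respStepBmSeq (d := 3) (toSite rr) Lc) i n)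
            (legChain (respStepBmSeq (d := 3) (toSite rr) Lc) i n) (SLam Lc c (fun μ y => hessFFAt (toSite rr) Lc μ y)) κ' u' x z a b
          - push₃ (respStep (d := 3) (Lc ^ i) (Lc ^ (i + n + 1))) (respStep (d := 3) (Lc ^ i) (Lc ^ (i + n + 1)))
            (respStep (d := 3) (Lc ^ i) (Lc ^ (i + n + 1))) (SLam Lc c (fun μ y => hessFFAt (toSite rr) Lc μ y)) κ' u' x z a b)|
      ≤ ((Lc : ℝ) ^ 3 * ((2 * (Lc : ℝ) ^ (3 + 1))⁻¹ * ((((3 : ℝ) + 1) * (Real.exp (2 * ((3 : ℝ) + 1) * min δK κ₁) ^ 2 *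
              (((2 * Lc : ℕ) : ℝ) ^ (3 + 1) * (((3 + 1 : ℕ) : ℝ) * ((Lc : ℝ) ^ (3 + 1) * (ell (3 + 1) Lc : ℝ)))))))
            * (C₁ * (TΔ * C₁ + 2 * Tb * cC)) * ((Lc : ℝ) * (64 + 544 * Lc + 768 * (Lc : ℝ) ^ 2)) * Zl (3 + 1) (min δK κ₁ / (4 * ((3 : ℝ) + 1)))))
          * ((((n : ℝ) + 1)) * ((Lc : ℝ)⁻¹) ^ (n + 1)) * θ ^ (i + n)
          * Real.exp (-(min δK κ₁ / 12) * (supNorm (x - u') + supNorm (z - u'))) := by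
  have hLc1 : 1 ≤ Lc := le_trans (by norm_num) hLc
  have hL : (0 : ℝ) < (Lc : ℝ) := Nat.cast_pos.2 (Nat.pos_of_ne_zero (NeZero.ne Lc))
  have hLn1 : 1 ≤ Lc ^ (n + 1) := Nat.one_le_pow _ _ hLc1
  have hκ : 0 < min δK κ₁ := lt_min hδK hκ₁
  have hκK : min δK κ₁ ≤ δK := min_le_left _ _
  have hκ1 : min δK κ₁ ≤ κ₁ := min_le_right _ _
  have hθp : 0 ≤ θ ^ (i + n) := pow_nonneg hθ _
  -- the legs
  set T' := legChain (respStepBmSeq (d := 3) (toSite rr) Lc) (i + 1) n with hT'def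
  set B' := respStep (d := 3) (Lc ^ (i + 1)) (Lc ^ (i + 1 + n + 1)) with hB'def
  set T := legChain (respStepBmSeq (d := 3) (toSite rr) Lc) i n with hTdef
  set B := respStep (d := 3) (Lc ^ i) (Lc ^ (i + n + 1)) with hBdef
  have hT' : ∀ μ z' l u, |T' μ z' l u| ≤ KE := abs_le_of_env' hκE.le (hE (i + 1))
  have hTs' : ∀ μ z' l, Summable fun u => T' μ z' l u := summable_of_env' hLn1 hκE (hE (i + 1))
  have hT : ∀ μ z' l u, |T μ z' l u| ≤ KE := abs_le_of_env' hκE.le (hE i)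
  have hTs : ∀ μ z' l, Summable fun u => T μ z' l u := summable_of_env' hLn1 hκE (hE i)
  have hBn' : ∀ μ z' l u, |B' μ z' l u| ≤ C₁ * ((Lc : ℝ) ^ (5 * (n + 1)))⁻¹ * Real.exp (-(min δK κ₁ * supNorm (quo (Lc ^ (n + 1)) u - z'))) := by
    intro μ z' l u
    exact (hN1 (i + 1) n μ z' l u).trans (mul_le_mul_of_nonneg_left (exp_env_mono_rate hκ1 (supNorm_nonneg _)) (by positivity))
  have hBn : ∀ μ z' l u, |B μ z' l u| ≤ C₁ * ((Lc : ℝ) ^ (5 * (n + 1)))⁻¹ * Real.exp (-(min δK κ₁ * supNorm (quo (Lc ^ (n + 1)) u - z'))) := by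
    intro μ z' l u
    exact (hN1 i n μ z' l u).trans (mul_le_mul_of_nonneg_left (exp_env_mono_rate hκ1 (supNorm_nonneg _)) (by positivity))
  have hBΔ : ∀ μ z' l u, |B' μ z' l u - B μ z' l u|
      ≤ (cC * θ ^ (i + n) * ((Lc : ℝ) ^ (5 * (n + 1)))⁻¹) * Real.exp (-(min δK κ₁ * supNorm (quo (Lc ^ (n + 1)) u - z'))) := by
    intro μ z' l u
    have h := hCau i n μ z' l u
    rw [show i + n + 2 = i + 1 + n + 1 by omega, inv_cast_pow_pow, show (3 + 2) * (n + 1) = 5 * (n + 1) by norm_num] at h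
    exact h.trans (mul_le_mul_of_nonneg_left (exp_env_mono_rate hκ1 (supNorm_nonneg _)) (by positivity))
  -- the gauge functions, their staircases and pieces
  obtain ⟨lam', hlam'def⟩ : ∃ f : Fin (3 + 1) → Site (3 + 1) → Site (3 + 1) → ℝ, f = fun μ z' =>
      Psi (toSite rr) Lc (i + 1) n (delta1 μ z') - bmGaugeAt (toSite rr) (respStep (d := 3) (Lc ^ (i + 1)) (Lc ^ (i + 1 + n + 1)) μ z') Lc := ⟨_, rfl⟩
  obtain ⟨lam, hlamdef⟩ : ∃ f : Fin (3 + 1) → Site (3 + 1) → Site (3 + 1) → ℝ, f = fun μ z' =>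
      Psi (toSite rr) Lc i n (delta1 μ z') - bmGaugeAt (toSite rr) (respStep (d := 3) (Lc ^ i) (Lc ^ (i + n + 1)) μ z') Lc := ⟨_, rfl⟩
  obtain ⟨Gp', hGp'def⟩ : ∃ G : Fin (3 + 1) → Site (3 + 1) → ℕ → Site (3 + 1) → ℝ, G = fun μ₀ z₀ s y =>
      if s = 0 then -bmGaugeAt (toSite rr) (respStep (d := 3) (Lc ^ (i + 1)) (Lc ^ (i + 1 + n + 1)) μ₀ z₀) Lc y
      else -(((Lc : ℝ) ^ ((3 + 1) * s))⁻¹ *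
        bmGaugeAt (toSite rr) (legAct (respStep (d := 3) (Lc ^ (i + 1 + s)) (Lc ^ (i + 1 + n + 1))) (delta1 μ₀ z₀)) Lc y) := ⟨_, rfl⟩
  obtain ⟨Gp, hGpdef⟩ : ∃ G : Fin (3 + 1) → Site (3 + 1) → ℕ → Site (3 + 1) → ℝ, G = fun μ₀ z₀ s y =>
      if s = 0 then -bmGaugeAt (toSite rr) (respStep (d := 3) (Lc ^ i) (Lc ^ (i + n + 1)) μ₀ z₀) Lc y
      else -(((Lc : ℝ) ^ ((3 + 1) * s))⁻¹ *
        bmGaugeAt (toSite rr) (legAct (respStep (d := 3) (Lc ^ (i + s)) (Lc ^ (i + n + 1))) (delta1 μ₀ z₀)) Lc y) := ⟨_, rfl⟩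
  obtain ⟨GΔ, hGΔdef⟩ : ∃ G : Fin (3 + 1) → Site (3 + 1) → ℕ → Site (3 + 1) → ℝ, G = fun μ₀ z₀ s y =>
      -(((Lc : ℝ) ^ ((3 + 1) * s))⁻¹ *
        bmGaugeAt (toSite rr) (legAct (respStep (d := 3) (Lc ^ (i + 1 + s)) (Lc ^ (i + 1 + n + 1))) (delta1 μ₀ z₀)
          - legAct (respStep (d := 3) (Lc ^ (i + s)) (Lc ^ (i + n + 1))) (delta1 μ₀ z₀)) Lc y) := ⟨_, rfl⟩
  have hTB' : T' - B' = fun μ z' l u => dz (lam' μ z') l u := by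
    have hik : i + 1 < i + 1 + n + 1 := by omega
    have h := BornLambdaLineage.legChain_sub_respStep_of_lt (d := 3) (Lc := Lc) hrr hik
    rw [show i + 1 + n + 1 - 1 - (i + 1) = n by omega] at h
    rw [hlam'def]
    exact h
  have hTB : T - B = fun μ z' l u => dz (lam μ z') l u := by
    have hik : i < i + n + 1 := by omega
    have h := BornLambdaLineage.legChain_sub_respStep_of_lt (d := 3) (Lc := Lc) hrr hik
    rw [show i + n + 1 - 1 - i = n by omega] at h
    rw [hlamdef]
    exact h
  have hlamB' : ∀ μ z' u, |lam' μ z' u| ≤ Clam := fun μ z' u => by rw [hlam'def]; exact hlam (i + 1) μ z' u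
  have hlamB : ∀ μ z' u, |lam μ z' u| ≤ Clam := fun μ z' u => by rw [hlamdef]; exact hlam i μ z' u
  have hψ' : ∀ (μ₀ : Fin (3 + 1)) (z₀ u : Site (3 + 1)), lam' μ₀ z₀ u = ∑ s ∈ Finset.range (n + 1), Gp' μ₀ z₀ s (blk (Lc ^ s) u) := by
    intro μ₀ z₀ u
    have h := gauge_eq_staircase (Lc := Lc) (toSite rr) (i + 1) n μ₀ z₀ u
    simp only [hlam'def, hGp'def, Pi.sub_apply] at h ⊢
    exact h
  have hψ : ∀ (μ₀ : Fin (3 + 1)) (z₀ u : Site (3 + 1)), lam μ₀ z₀ u = ∑ s ∈ Finset.range (n + 1), Gp μ₀ z₀ s (blk (Lc ^ s) u) := by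
    intro μ₀ z₀ u
    have h := gauge_eq_staircase (Lc := Lc) (toSite rr) i n μ₀ z₀ u
    simp only [hlamdef, hGpdef, Pi.sub_apply] at h ⊢
    exact h
  have hψΔ : ∀ (μ₀ : Fin (3 + 1)) (z₀ u : Site (3 + 1)), lam' μ₀ z₀ u - lam μ₀ z₀ u = ∑ s ∈ Finset.range (n + 1), GΔ μ₀ z₀ s (blk (Lc ^ s) u) := by
    intro μ₀ z₀ u
    have h := gauge_succ_sub_eq_staircase (Lc := Lc) (toSite rr) i n μ₀ z₀ u
    simp only [hlam'def, hlamdef, hGΔdef, Pi.sub_apply] at h ⊢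
    exact h
  have hG' : ∀ (μ₀ : Fin (3 + 1)) (z₀ : Site (3 + 1)) (s : ℕ), s ≤ n → ∀ u : Site (3 + 1),
      |Gp' μ₀ z₀ s (blk (Lc ^ s) u)| ≤ (8 * (Lc : ℝ) * C₁ * ((Lc : ℝ) ^ (5 * (n + 1)))⁻¹) * (Lc : ℝ) ^ s * Real.exp (-(min δK κ₁ * supNorm (quo (Lc ^ (n + 1)) u - z₀))) := by
    intro μ₀ z₀ s hs u
    have h := abs_gaugePiece_le (Lc := Lc) hN1 hrr (i + 1) n μ₀ z₀ hs u
    simp only [hGp'def] at h ⊢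
    exact h.trans (mul_le_mul_of_nonneg_left (exp_env_mono_rate hκ1 (supNorm_nonneg _)) (by positivity))
  have hG : ∀ (μ₀ : Fin (3 + 1)) (z₀ : Site (3 + 1)) (s : ℕ), s ≤ n → ∀ u : Site (3 + 1),
      |Gp μ₀ z₀ s (blk (Lc ^ s) u)| ≤ (8 * (Lc : ℝ) * C₁ * ((Lc : ℝ) ^ (5 * (n + 1)))⁻¹) * (Lc : ℝ) ^ s * Real.exp (-(min δK κ₁ * supNorm (quo (Lc ^ (n + 1)) u - z₀))) := by
    intro μ₀ z₀ s hs u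
    have h := abs_gaugePiece_le (Lc := Lc) hN1 hrr i n μ₀ z₀ hs u
    simp only [hGpdef] at h ⊢
    exact h.trans (mul_le_mul_of_nonneg_left (exp_env_mono_rate hκ1 (supNorm_nonneg _)) (by positivity))
  have hGΔ : ∀ (μ₀ : Fin (3 + 1)) (z₀ : Site (3 + 1)) (s : ℕ), s ≤ n → ∀ u : Site (3 + 1),
      |GΔ μ₀ z₀ s (blk (Lc ^ s) u)| ≤ (8 * (Lc : ℝ) * (cC * θ ^ (i + n)) * ((Lc : ℝ) ^ (5 * (n + 1)))⁻¹) * (Lc : ℝ) ^ s *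
        Real.exp (-(min δK κ₁ * supNorm (quo (Lc ^ (n + 1)) u - z₀))) := by
    intro μ₀ z₀ s hs u
    have h := abs_gaugePieceSucc_le (Lc := Lc) hCau hrr i n μ₀ z₀ hs u
    simp only [hGΔdef] at h ⊢
    exact h.trans (mul_le_mul_of_nonneg_left (exp_env_mono_rate hκ1 (supNorm_nonneg _)) (by positivity))
  -- the brackets at the common rate
  have hqi : 0 ≤ ((((Lc : ℝ) ^ n) ^ (2 * 3 + 1))⁻¹) := by positivity
  have hbrK' : ∀ (κ' : Fin (3 + 1)) (u' : Site (3 + 1)) μ y, |∑' u, ∑ l, T' κ' u' l u * c' μ y l u|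
      ≤ (Tb * ((((Lc : ℝ) ^ n) ^ (2 * 3 + 1))⁻¹)) * Real.exp (-(min δK κ₁ * supNorm (quo (Lc ^ n) y - u'))) := fun κ' u' μ y =>
    (hbr' κ' u' μ y).trans (mul_le_mul_of_nonneg_left (exp_env_mono_rate hκK (supNorm_nonneg _)) (by positivity))
  have hbrK : ∀ (κ' : Fin (3 + 1)) (u' : Site (3 + 1)) μ y, |∑' u, ∑ l, T κ' u' l u * c μ y l u|
      ≤ (Tb * ((((Lc : ℝ) ^ n) ^ (2 * 3 + 1))⁻¹)) * Real.exp (-(min δK κ₁ * supNorm (quo (Lc ^ n) y - u'))) := fun κ' u' μ y =>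
    (hbr κ' u' μ y).trans (mul_le_mul_of_nonneg_left (exp_env_mono_rate hκK (supNorm_nonneg _)) (by positivity))
  have hbrKΔ : ∀ (κ' : Fin (3 + 1)) (u' : Site (3 + 1)) μ y,
      |(∑' u, ∑ l, T' κ' u' l u * c' μ y l u) - ∑' u, ∑ l, T κ' u' l u * c μ y l u|
        ≤ (TΔ * θ ^ (i + n) * ((((Lc : ℝ) ^ n) ^ (2 * 3 + 1))⁻¹)) * Real.exp (-(min δK κ₁ * supNorm (quo (Lc ^ n) y - u'))) := fun κ' u' μ y =>
    (hbrΔ κ' u' μ y).trans (mul_le_mul_of_nonneg_left (exp_env_mono_rate hκK (supNorm_nonneg _)) (by positivity))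
  -- the `inl∕inl` block by D2c; the others vanish
  have hS1 := isFF_push₃ (l := T') (r := T') (w := T') (SLam Lc c' (fun μ y => hessFFAt (toSite rr) Lc μ y)) κ' u'
  have hS1' := isFF_push₃ (l := B') (r := B') (w := B') (SLam Lc c' (fun μ y => hessFFAt (toSite rr) Lc μ y)) κ' u'
  have hS0 := isFF_push₃ (l := T) (r := T) (w := T) (SLam Lc c (fun μ y => hessFFAt (toSite rr) Lc μ y)) κ' u'
  have hS0' := isFF_push₃ (l := B) (r := B) (w := B) (SLam Lc c (fun μ y => hessFFAt (toSite rr) Lc μ y)) κ' u'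
  have hZ : 0 ≤ Zl (3 + 1) (min δK κ₁ / (4 * ((3 : ℝ) + 1))) := Zl_nonneg (by positivity)
  have hRHS0 : 0 ≤ ((Lc : ℝ) ^ 3 * ((2 * (Lc : ℝ) ^ (3 + 1))⁻¹ * ((((3 : ℝ) + 1) * (Real.exp (2 * ((3 : ℝ) + 1) * min δK κ₁) ^ 2 *
              (((2 * Lc : ℕ) : ℝ) ^ (3 + 1) * (((3 + 1 : ℕ) : ℝ) * ((Lc : ℝ) ^ (3 + 1) * (ell (3 + 1) Lc : ℝ)))))))
            * (C₁ * (TΔ * C₁ + 2 * Tb * cC)) * ((Lc : ℝ) * (64 + 544 * Lc + 768 * (Lc : ℝ) ^ 2)) * Zl (3 + 1) (min δK κ₁ / (4 * ((3 : ℝ) + 1)))))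
          * ((((n : ℝ) + 1)) * ((Lc : ℝ)⁻¹) ^ (n + 1)) * θ ^ (i + n)
          * Real.exp (-(min δK κ₁ / 12) * (supNorm (x - u') + supNorm (z - u'))) := by positivity
  rcases a with α | μa
  · rcases b with β | νb
    · have hmain := abs_contactPair_entry_le (d := 3) (Lc := Lc) (rr := rr) (n := n) (κ := min δK κ₁)
        (αg' := 8 * (Lc : ℝ) * C₁ * ((Lc : ℝ) ^ (5 * (n + 1)))⁻¹) (αg := 8 * (Lc : ℝ) * C₁ * ((Lc : ℝ) ^ (5 * (n + 1)))⁻¹)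
        (αΔ := 8 * (Lc : ℝ) * (cC * θ ^ (i + n)) * ((Lc : ℝ) ^ (5 * (n + 1)))⁻¹)
        (KB' := C₁ * ((Lc : ℝ) ^ (5 * (n + 1)))⁻¹) (KB := C₁ * ((Lc : ℝ) ^ (5 * (n + 1)))⁻¹) (KΔ := cC * θ ^ (i + n) * ((Lc : ℝ) ^ (5 * (n + 1)))⁻¹)
        (Tb' := Tb * ((((Lc : ℝ) ^ n) ^ (2 * 3 + 1))⁻¹)) (Tb := Tb * ((((Lc : ℝ) ^ n) ^ (2 * 3 + 1))⁻¹))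
        (TbΔ := TΔ * θ ^ (i + n) * ((((Lc : ℝ) ^ n) ^ (2 * 3 + 1))⁻¹))
        (T' := T') (B' := B') (T := T) (B := B) (lam' := lam') (lam := lam) (G' := Gp') (G := Gp) (GΔ := GΔ) (c' := c') (c := c)
        hLc1 hrr hκ (by positivity) (by positivity) (by positivity) (by positivity) (by positivity) (by positivity) (by positivity) (by positivity)
        (by positivity)
        hc' hδc' hCc' hdiv' hT' hTs' hBn' hTB' hlamB' hψ' hG' hbrK'
        hc hδc hCc hdiv hT hTs hBn hTB hlamB hψ hG hbrK
        hψΔ hGΔ hBΔ hbrKΔ κ' u' x z α β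
      rw [← mul_sub, abs_mul, abs_pow]
      have hw0 : 0 ≤ |cE * (Lc : ℝ) ^ (2 * (3 + 1))| ^ (n + 1) := pow_nonneg (abs_nonneg _) _
      refine (mul_le_mul_of_nonneg_left hmain hw0).trans ?_
      have hP := poly_le (Lc := Lc) n
      have hU := units_le (Lc := Lc) hcE n
      -- names
      set E2C : ℝ := Real.exp (2 * ((3 : ℝ) + 1) * min δK κ₁) ^ 2 *
          (((2 * Lc : ℕ) : ℝ) ^ (3 + 1) * (((3 + 1 : ℕ) : ℝ) * ((Lc : ℝ) ^ (3 + 1) * (ell (3 + 1) Lc : ℝ)))) with hE2C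
      set Zc : ℝ := Zl (3 + 1) (min δK κ₁ / (4 * ((3 : ℝ) + 1))) with hZdef
      set W : ℝ := |cE * (Lc : ℝ) ^ (2 * (3 + 1))| ^ (n + 1) with hWdef
      set EX : ℝ := Real.exp (-(min δK κ₁ / 12) * (supNorm (x - u') + supNorm (z - u'))) with hEX
      set Xi : ℝ := ((Lc : ℝ) ^ (5 * (n + 1)))⁻¹ with hXi
      set qi : ℝ := ((((Lc : ℝ) ^ n) ^ (2 * 3 + 1))⁻¹) with hqidef
      set Q4 : ℝ := (((Lc ^ n : ℕ) : ℝ)) ^ (3 + 1) with hQ4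
      set θp : ℝ := θ ^ (i + n) with hθpdef
      set P0 : ℝ := C₁ * (TΔ * C₁ + 2 * Tb * cC) with hP0
      set PL : ℝ := (Lc : ℝ) * (64 + 544 * Lc + 768 * (Lc : ℝ) ^ 2) with hPL
      have hE0 : 0 ≤ E2C := by positivity
      have hW0 : 0 ≤ W := hw0
      have hEX0 : 0 ≤ EX := (Real.exp_pos _).le
      have hXi0 : 0 ≤ Xi := by positivity
      have hP00 : 0 ≤ P0 := by positivity
      have hθp0 : 0 ≤ θp := hθp
      have hqi0 : 0 ≤ qi := hqi
      have hQ40 : 0 ≤ Q4 := by positivity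
      have hPL0 : 0 ≤ PL := by positivity
      have hZc0 : 0 ≤ Zc := hZ
      clear_value E2C Zc W EX Xi qi Q4 θp P0 PL
      -- the three cell-pair polynomials are `θp·qi·Xi²·P0·(64Lc + 512Lc² + (32Lc² + 768Lc³)·n)` exactly
      have hpoly :
          ((TΔ * θp * qi) * (C₁ * Xi) * (4 * (8 * (Lc : ℝ) * C₁ * Xi) + 2 * (8 * (Lc : ℝ) * C₁ * Xi) * Lc * n)
              + (Tb * qi) * (C₁ * Xi) * (4 * (8 * (Lc : ℝ) * (cC * θp) * Xi) + 2 * (8 * (Lc : ℝ) * (cC * θp) * Xi) * Lc * n)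
              + (Tb * qi) * (cC * θp * Xi) * (4 * (8 * (Lc : ℝ) * C₁ * Xi) + 2 * (8 * (Lc : ℝ) * C₁ * Xi) * Lc * n))
            + ((TΔ * θp * qi) * (8 * ((8 * (Lc : ℝ) * C₁ * Xi) * (8 * (Lc : ℝ) * C₁ * Xi)) + 2 * (6 * ((8 * (Lc : ℝ) * C₁ * Xi) * (8 * (Lc : ℝ) * C₁ * Xi))) * Lc * n)
              + (Tb * qi) * (8 * ((8 * (Lc : ℝ) * (cC * θp) * Xi) * (8 * (Lc : ℝ) * C₁ * Xi)) + 2 * (6 * ((8 * (Lc : ℝ) * (cC * θp) * Xi) * (8 * (Lc : ℝ) * C₁ * Xi))) * Lc * n)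
              + (Tb * qi) * (8 * ((8 * (Lc : ℝ) * C₁ * Xi) * (8 * (Lc : ℝ) * (cC * θp) * Xi)) + 2 * (6 * ((8 * (Lc : ℝ) * C₁ * Xi) * (8 * (Lc : ℝ) * (cC * θp) * Xi))) * Lc * n))
            + ((TΔ * θp * qi) * (C₁ * Xi) * (4 * (8 * (Lc : ℝ) * C₁ * Xi) + 2 * (8 * (Lc : ℝ) * C₁ * Xi) * Lc * n)
              + (Tb * qi) * (C₁ * Xi) * (4 * (8 * (Lc : ℝ) * (cC * θp) * Xi) + 2 * (8 * (Lc : ℝ) * (cC * θp) * Xi) * Lc * n)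
              + (Tb * qi) * (cC * θp * Xi) * (4 * (8 * (Lc : ℝ) * C₁ * Xi) + 2 * (8 * (Lc : ℝ) * C₁ * Xi) * Lc * n))
          = θp * qi * Xi ^ 2 * P0 * (64 * (Lc : ℝ) + 512 * (Lc : ℝ) ^ 2 + (32 * (Lc : ℝ) ^ 2 + 768 * (Lc : ℝ) ^ 3) * n) := by
        rw [hP0]; ring
      -- regroup: W·(w·(4·E2C·(M+D+M)·(Q4·Zc)·EX)) = (W·(qi·(Xi²·Q4)))·((w·(4·E2C)·P0·Zc)·poly·θp·EX)
      have step1 : W * ((2 * (Lc : ℝ) ^ (3 + 1))⁻¹ * ((((3 : ℝ) + 1) * E2C)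
            * (θp * qi * Xi ^ 2 * P0 * (64 * (Lc : ℝ) + 512 * (Lc : ℝ) ^ 2 + (32 * (Lc : ℝ) ^ 2 + 768 * (Lc : ℝ) ^ 3) * n))
            * (Q4 * Zc) * EX))
          ≤ W * ((2 * (Lc : ℝ) ^ (3 + 1))⁻¹ * ((((3 : ℝ) + 1) * E2C)
            * (θp * qi * Xi ^ 2 * P0 * (((n : ℝ) + 1) * PL))
            * (Q4 * Zc) * EX)) := by
        refine mul_le_mul_of_nonneg_left (mul_le_mul_of_nonneg_left ?_ (by positivity)) hW0
        have h1 : 0 ≤ ((3 : ℝ) + 1) * E2C := by positivity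
        have h2 : 0 ≤ Q4 * Zc := by positivity
        have h3 : 0 ≤ θp * qi * Xi ^ 2 * P0 := by positivity
        have h4 : θp * qi * Xi ^ 2 * P0 * (64 * (Lc : ℝ) + 512 * (Lc : ℝ) ^ 2 + (32 * (Lc : ℝ) ^ 2 + 768 * (Lc : ℝ) ^ 3) * n)
            ≤ θp * qi * Xi ^ 2 * P0 * (((n : ℝ) + 1) * PL) := mul_le_mul_of_nonneg_left hP h3
        gcongr
      refine (le_of_eq ?_).trans (step1.trans ?_)
      · rw [← hpoly, hE2C, hZdef, hEX, hqidef, hXi, hθpdef, hQ4]; ring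
      · have hR0 : 0 ≤ ((2 * (Lc : ℝ) ^ (3 + 1))⁻¹ * ((((3 : ℝ) + 1) * E2C) * P0 * PL * Zc)) * (((n : ℝ) + 1)) * θp * EX := by positivity
        calc W * ((2 * (Lc : ℝ) ^ (3 + 1))⁻¹ * ((((3 : ℝ) + 1) * E2C) * (θp * qi * Xi ^ 2 * P0 * (((n : ℝ) + 1) * PL)) * (Q4 * Zc) * EX))
            = (W * (qi * (Xi ^ 2 * Q4))) * (((2 * (Lc : ℝ) ^ (3 + 1))⁻¹ * ((((3 : ℝ) + 1) * E2C) * P0 * PL * Zc)) * (((n : ℝ) + 1)) * θp * EX) := by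
              ring
          _ ≤ ((Lc : ℝ) ^ 3 * ((Lc : ℝ)⁻¹) ^ (n + 1))
              * (((2 * (Lc : ℝ) ^ (3 + 1))⁻¹ * ((((3 : ℝ) + 1) * E2C) * P0 * PL * Zc)) * (((n : ℝ) + 1)) * θp * EX) := by
              exact mul_le_mul_of_nonneg_right hU hR0
          _ = _ := by rw [hE2C, hZdef, hEX, hθpdef, hP0, hPL]; ring
    · rw [hS1.2 x z (Sum.inl α) νb, hS1'.2 x z (Sum.inl α) νb, hS0.2 x z (Sum.inl α) νb, hS0'.2 x z (Sum.inl α) νb]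
      simp only [sub_self, mul_zero, abs_zero]
      exact hRHS0
  · rw [hS1.1 x z μa b, hS1'.1 x z μa b, hS0.1 x z μa b, hS0'.1 x z μa b]
    simp only [sub_self, mul_zero, abs_zero]
    exact hRHS0

end Pair

end Summit.QuantumFields.BalabanUV.Beta.GAN24.BornLambdaContactPairLineage

end
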